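import Summits.AnomalousDissipation.AnomalousDissipation.Theses.MirrorVariety
import Literature.Analysis.FunctionSpaces.TorusWeakFormBookkeeping
import Literature.Analysis.FunctionSpaces.TorusClassicalNSUniqueness
import Literature.Analysis.FluidPDE.SteadyNavierStokesProofs
import Literature.Analysis.FluidPDE.TorusClassicalLerayHopfProofs
import Literature.Analysis.FluidPDE.EnergySpaceTorusProofs
import Literature.Analysis.FluidPDE.LongTimeAveragePeriodic
import Mathlib.Analysis.Calculus.ParametricIntegral

/-!
# Route MirrorVariety — support `SteadyWeakIsGlobalLerayHopf` (stmt-AnomalousDissipation-2992)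

Folklore glue (Galdi 2000, Def. 2.1; Doering–Foias 2002 §2; Robinson–Rodrigo–Sadowski 2016,
Def. 4.9): a steady weak solution `u ∈ V` of the forced Navier–Stokes equations on `T³` (`ν > 0`,
`f` smooth with `∫ f = 0`) satisfying the energy equation `ν ‖∇u‖² = (u, f)`, viewed as the
constant path `t ↦ u` (the `L²` representative), is a global Leray–Hopf solution from the datum
`u`, and its long-time means are `meanEnergy = ∫ |u|²`, `meanDissipation = ν ‖∇u‖²`.

* weak form: for a space–time test `ψ` supported in `[0, T)` the time-derivative term is
  `∫₀ᵀ ∫ ⟪u, ∂ₜψ⟫ = -∫ ⟪u, ψ 0⟫` (differentiation under the integral sign and the fundamental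
  theorem of calculus, `setIntegral_integral_inner_timeDeriv_eq_neg`), cancelling the datum term,
  while every slice term `∫ (⟪u, (u·∇)ψ_t⟫ + ν ⟪u, Δψ_t⟫ + ⟪f, ψ_t⟫)` vanishes by the steady weak
  form extended from mean-zero to all smooth divergence-free tests by subtracting the mean
  (`∫ f = 0`, `Δ const = 0`, `D const = 0`; `integral_tested_eq_zero_of_isSteadyWeakSolution`);
* the energy inequalities hold with equality (both sides are linear in `t`);
* `L^∞L²`, `L²H¹`, weak continuity and strong attainment of the datum are trivial for a constant
  path with `u ∈ V`; measurability of the space–time lift is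
  `Torus.aestronglyMeasurable_stLift_of_uncurry`;
* the long-time means of the constant (`1`-periodic) path are its slice values
  (`meanEnergy_eq_of_periodic`, `meanDissipation_eq_of_periodic` of `LongTimeAveragePeriodic`).

Main results: `isLerayHopfOn_steady`, `isGlobalLerayHopf_steady` and
`steadyWeakIsGlobalLerayHopf_proof : SteadyWeakIsGlobalLerayHopf` (the route decl, verbatim). Small
pointwise facts (`D const = 0`, `Δ const = 0`, `div (a - const) = div a`) are kept as local steps, the
tree having them only in unrelated namespaces.
-/

-- `Summit.<Summit>.<Problem>` is the tree's mandated summit-side namespace (CONVENTIONS §2); for this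
-- single-conjunct summit the two coincide, so the duplicate is deliberate.
set_option linter.dupNamespace false

noncomputable section

open MeasureTheory Filter Topology UnitAddTorus Set Function
open scoped InnerProductSpace RealInnerProductSpace ENNReal NNReal
open Literature.Analysis.FunctionSpaces Literature.Analysis.FunctionSpaces.Torus
open Literature.Analysis.FluidPDE Literature.Analysis.FluidPDE.Torus

namespace Summit.AnomalousDissipation.AnomalousDissipation.Theorems

/-! ## The time-derivative term against a steady `L²` field -/

/-- Differentiation under the integral sign: for a space–time test field `ψ` and `w ∈ L²(T³)`,
`s ↦ ∫ ⟪w, ψ s⟫` has derivative `∫ ⟪w, ∂ₜψ s⟫` (dominated by `‖w‖ sup |∂ₜψ|` near `s`). [folklore] -/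
theorem hasDerivAt_integral_inner_spaceTimeTest {T : ℝ}
    {ψ : ℝ → UnitAddTorus (Fin 3) → EuclideanSpace ℝ (Fin 3)} (hψ : IsSpaceTimeTest T ψ)
    {w : UnitAddTorus (Fin 3) → EuclideanSpace ℝ (Fin 3)} (hw : MemLp w 2 volume) (t₀ : ℝ) :
    HasDerivAt (fun τ => ∫ x, ⟪w x, ψ τ x⟫_ℝ) (∫ x, ⟪w x, Torus.timeDeriv ψ t₀ x⟫_ℝ) t₀ := by
  obtain ⟨M, hM⟩ := hψ.exists_bound_timeDeriv (isCompact_Icc (a := t₀ - 1) (b := t₀ + 1))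
  have hw1 : Integrable w volume := hw.integrable one_le_two
  have hdiff : ∀ (x : UnitAddTorus (Fin 3)) (τ : ℝ),
      HasDerivAt (fun τ => ψ τ x) (Torus.timeDeriv ψ τ x) τ := by
    intro x τ
    obtain ⟨y, rfl⟩ := proj_surjective x
    have hd : Differentiable ℝ (fun τ : ℝ => stLift ψ (τ, y)) :=
      (hψ.1.differentiable (by simp)).comp (differentiable_id.prodMk (differentiable_const y))
    exact (hd τ).hasDerivAt
  have key := hasDerivAt_integral_of_dominated_loc_of_deriv_le (μ := volume)
    (F := fun τ x => ⟪w x, ψ τ x⟫_ℝ) (F' := fun τ x => ⟪w x, Torus.timeDeriv ψ τ x⟫_ℝ) (x₀ := t₀)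
    (bound := fun x => ‖w x‖ * |M|) (s := Icc (t₀ - 1) (t₀ + 1))
    (Icc_mem_nhds (by linarith) (by linarith)) ?_ ?_ ?_ ?_ ?_ ?_
  · exact key.2
  · exact Eventually.of_forall fun τ =>
      hw.1.inner (hψ.isSmooth_slice τ).continuous.aestronglyMeasurable
  · obtain ⟨M0, hM0⟩ := hψ.exists_bound (isCompact_singleton (x := t₀))
    exact integrable_inner_slice (U := fun _ => w) (Φ := ψ) hw1 hψ.continuous_uncurry (hM0 t₀ rfl)
  · exact hw.1.inner (hψ.timeDeriv.isSmooth_slice t₀).continuous.aestronglyMeasurable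
  · refine ae_of_all _ fun x τ hτ => ?_
    calc ‖⟪w x, Torus.timeDeriv ψ τ x⟫_ℝ‖ ≤ ‖w x‖ * ‖Torus.timeDeriv ψ τ x‖ :=
          norm_inner_le_norm _ _
      _ ≤ ‖w x‖ * |M| :=
          mul_le_mul_of_nonneg_left ((hM τ hτ x).trans (le_abs_self M)) (norm_nonneg _)
  · exact hw1.norm.mul_const _
  · refine ae_of_all _ fun x τ _ => ?_
    exact ((hasDerivAt_const τ (w x)).inner ℝ (hdiff x τ)).congr_deriv (by simp)

/-- **The time-derivative term of a steady field**: for `T > 0`, a space–time test field `ψ`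
on `[0, T)` and `w ∈ L²(T³)`, `∫_{(0,T)} ∫ ⟪w, ∂ₜψ t⟫ dt = -∫ ⟪w, ψ 0⟫` (fundamental theorem
of calculus for `t ↦ ∫ ⟪w, ψ t⟫`, which is `C¹` and vanishes at `t = T`). [folklore] -/
theorem setIntegral_integral_inner_timeDeriv_eq_neg {T : ℝ} (hT : 0 < T)
    {ψ : ℝ → UnitAddTorus (Fin 3) → EuclideanSpace ℝ (Fin 3)} (hψ : IsSpaceTimeTest T ψ)
    {w : UnitAddTorus (Fin 3) → EuclideanSpace ℝ (Fin 3)} (hw : MemLp w 2 volume) :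
    ∫ t in Ioo 0 T, ∫ x, ⟪w x, Torus.timeDeriv ψ t x⟫_ℝ = -∫ x, ⟪w x, ψ 0 x⟫_ℝ := by
  obtain ⟨T', hT'T, hT'⟩ := hψ.2
  have hcont : Continuous fun t => ∫ x, ⟪w x, Torus.timeDeriv ψ t x⟫_ℝ := by
    have h := (hψ.timeDeriv.isSmoothSpaceTimeOn univ).continuousOn_integral_inner hw
    rw [continuousOn_univ] at h
    refine h.congr fun t => ?_
    exact integral_congr_ae (ae_of_all _ fun x => real_inner_comm _ _)
  rw [← integral_Ioc_eq_integral_Ioo, ← intervalIntegral.integral_of_le hT.le,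
    intervalIntegral.integral_eq_sub_of_hasDerivAt
      (fun t _ => hasDerivAt_integral_inner_spaceTimeTest hψ hw t) (hcont.intervalIntegrable _ _),
    hT' T hT'T.le]
  simp

/-! ## The steady weak form against all smooth divergence-free tests -/

/-- **Steady weak solutions test against every smooth divergence-free field** (not only the
mean-zero ones) when the force has zero mean: for `u` a steady weak solution, `f` smooth with
`∫ f = 0`, and `a` smooth divergence free,
`∫ (⟪u, (u·∇)a⟫ + ν ⟪u, Δa⟫ + ⟪f, a⟫) = 0` — test with `a − ∫a ∈ 𝒱` and use `D const = 0`,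
`Δ const = 0`, `∫ ⟪f, const⟫ = ⟪∫ f, const⟫ = 0`. [folklore] -/
theorem integral_tested_eq_zero_of_isSteadyWeakSolution {ν : ℝ}
    {f : UnitAddTorus (Fin 3) → EuclideanSpace ℝ (Fin 3)} (hf : IsSmooth f) (hzf : HasZeroMean f)
    {u : energySpace (Fin 3)} (hsol : IsSteadyWeakSolution ν f u)
    {a : UnitAddTorus (Fin 3) → EuclideanSpace ℝ (Fin 3)} (ha : IsSmooth a) (hadiv : IsDivFree a) :
    ∫ x, (⟪((u : Lp (EuclideanSpace ℝ (Fin 3)) 2 (volume : Measure (UnitAddTorus (Fin 3)))) :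
          UnitAddTorus (Fin 3) → EuclideanSpace ℝ (Fin 3)) x,
        convect ((u : Lp (EuclideanSpace ℝ (Fin 3)) 2 (volume : Measure (UnitAddTorus (Fin 3)))) :
          UnitAddTorus (Fin 3) → EuclideanSpace ℝ (Fin 3)) a x⟫_ℝ +
      ν * ⟪((u : Lp (EuclideanSpace ℝ (Fin 3)) 2 (volume : Measure (UnitAddTorus (Fin 3)))) :
          UnitAddTorus (Fin 3) → EuclideanSpace ℝ (Fin 3)) x, laplacian a x⟫_ℝ +
      ⟪f x, a x⟫_ℝ) = 0 := by
  have hw2 : MemLp ((u : Lp (EuclideanSpace ℝ (Fin 3)) 2 (volume : Measure (UnitAddTorus (Fin 3)))) :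
      UnitAddTorus (Fin 3) → EuclideanSpace ℝ (Fin 3)) 2 volume := Lp.memLp _
  -- the mean-corrected test field `a' = a - c`, `c = ∫ a`
  obtain ⟨c, hc⟩ : ∃ c : EuclideanSpace ℝ (Fin 3), c = ∫ x, a x := ⟨_, rfl⟩
  have hcs : IsSmooth (fun _ : UnitAddTorus (Fin 3) => c) := isSmooth_const c
  have ha' : IsSmooth (fun y => a y - c) := ha.sub hcs
  -- `div (a - c) = div a = 0`
  have hdiv' : IsDivFree (fun y => a y - c) := by
    intro x
    have h := hadiv x
    unfold divergence at h ⊢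
    have e : ∀ i, Torus.partialDeriv i (fun y => (a y - c) i) x =
        Torus.partialDeriv i (fun y => a y i) x := fun i => by
      simp [Torus.partialDeriv, Torus.lineDeriv]
    simp only [e]
    exact h
  -- `Δ c = 0` and `D c = 0`
  have hpc : ∀ (e : EuclideanSpace ℝ (Fin 3)) (i : Fin 3),
      Torus.partialDeriv i (fun _ : UnitAddTorus (Fin 3) => e) = fun _ => 0 := fun e i => by
    funext y
    simp [Torus.partialDeriv, Torus.lineDeriv]
  have hlapc : ∀ x, laplacian (fun _ : UnitAddTorus (Fin 3) => c) x = 0 := fun x => by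
    rw [laplacian_eq_sum_partialDeriv_partialDeriv hcs]
    refine Finset.sum_eq_zero fun i _ => ?_
    rw [hpc c i, hpc 0 i]
  have hfdc : ∀ x, Torus.fderiv (fun _ : UnitAddTorus (Fin 3) => c) x = 0 := fun x => by
    show _root_.fderiv ℝ (fun _ : EuclideanSpace ℝ (Fin 3) => c) 0 = 0
    simp
  have hmean' : HasZeroMean (fun y => a y - c) := by
    unfold HasZeroMean
    rw [integral_sub ha.integrable (integrable_const c), integral_const]
    simp [hc]
  have h0 := hsol _ ha' hdiv' hmean'
  -- compare the generator at `a - c` with the tested functional at `a`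
  have e1 : (∫ x, ⟪f x, a x - c⟫_ℝ) = ∫ x, ⟪f x, a x⟫_ℝ := by
    have i1 : Integrable (fun x => ⟪f x, a x⟫_ℝ) volume := (hf.inner ha).integrable
    have i2 : Integrable (fun x => ⟪f x, c⟫_ℝ) volume := (hf.inner hcs).integrable
    simp only [inner_sub_right]
    rw [integral_sub i1 i2]
    have h3 : ∫ x, ⟪f x, c⟫_ℝ = 0 := by
      calc ∫ x, ⟪f x, c⟫_ℝ = ∫ x, ⟪c, f x⟫_ℝ :=
            integral_congr_ae (ae_of_all _ fun x => real_inner_comm _ _)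
        _ = ⟪c, ∫ x, f x⟫_ℝ := integral_inner hf.integrable c
        _ = 0 := by
            unfold HasZeroMean at hzf
            rw [hzf, inner_zero_right]
    rw [h3, sub_zero]
  have e2 : ∀ x, laplacian (fun y => a y - c) x = laplacian a x := fun x => by
    have h := congrFun (laplacian_sub ha hcs) x
    simp only [Pi.sub_apply, hlapc, sub_zero] at h
    exact h
  have e3 : ∀ x, Torus.fderiv (fun y => a y - c) x = Torus.fderiv a x := fun x => by
    have h := fderiv_sub (ha.isContDiff (by simp)) (hcs.isContDiff (by simp)) x
    rw [hfdc, sub_zero] at h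
    exact h
  unfold nsGeneratorPairing inertialPairing at h0
  simp_rw [e2, e3] at h0
  rw [e1] at h0
  rw [integral_weakForm_eq ν (hf.memLp 2) hw2 ha]
  exact h0

/-! ## The constant path is a Leray–Hopf solution -/

/-- **A steady field is a Leray–Hopf solution on every `[0, T)`** once it is in `L² ∩ H¹`,
weakly divergence free, solves the tested steady equations against every smooth
divergence-free field, and satisfies the energy identity `∫ ⟪f, w⟫ = ν ‖∇w‖²` (Galdi 2000,
Def. 2.1; Robinson–Rodrigo–Sadowski 2016, Def. 4.9: constant path, all inequalities are
equalities). [folklore] -/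
theorem isLerayHopfOn_steady {ν T : ℝ} (hT : 0 < T)
    {f w : UnitAddTorus (Fin 3) → EuclideanSpace ℝ (Fin 3)} (hf : IsSmooth f)
    (hw2 : MemLp w 2 volume) (hH1 : MemSobolev 1 (EuclideanSpace.complexify ∘ w))
    (hdivw : IsWeaklyDivFree w)
    (htest : ∀ a : UnitAddTorus (Fin 3) → EuclideanSpace ℝ (Fin 3), IsSmooth a → IsDivFree a →
      ∫ x, (⟪w x, convect w a x⟫_ℝ + ν * ⟪w x, laplacian a x⟫_ℝ + ⟪f x, a x⟫_ℝ) = 0)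
    (hK : ∫ x, ⟪f x, w x⟫_ℝ = ν * (eGradNormSq w).toReal) :
    IsLerayHopfOn T ν (fun _ => f) w (fun _ => w) := by
  have hw1 : Integrable w volume := hw2.integrable one_le_two
  have hL2fin : ∫⁻ x, ‖w x‖ₑ ^ 2 < ⊤ := by
    rw [Torus.lintegral_enorm_sq_eq_ofReal hw2]
    exact ENNReal.ofReal_lt_top
  have hdiss : ∀ s t : ℝ, s ≤ t →
      ν * (∫⁻ _ in Ioo s t, eGradNormSq w).toReal = ∫ _ in s..t, ∫ x, ⟪f x, w x⟫_ℝ := by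
    intro s t hst
    rw [setLIntegral_const, ENNReal.toReal_mul, Real.volume_Ioo,
      ENNReal.toReal_ofReal (sub_nonneg.2 hst), intervalIntegral.integral_const, smul_eq_mul, hK]
    ring
  refine
    { weak := ⟨?_, ?_, ae_of_all _ fun _ => hdivw, fun ψ hψ hψdiv => ?_⟩
      energy_bound := ⟨(∫⁻ x, ‖w x‖ₑ ^ 2).toNNReal, ae_of_all _ fun _ => ?_⟩
      memLp := fun _ _ => hw2
      memL2Sobolev := ⟨ae_of_all _ fun _ => hH1, ?_⟩
      energy_ineq_zero := fun t ht => ?_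
      energy_ineq_ae := ae_of_all _ fun s t hst => ?_
      weak_continuous := fun _ _ => ⟨continuousOn_const, tendsto_const_nhds⟩
      strong_initial := ?_ }
  -- measurability of the space–time lift
  · exact aestronglyMeasurable_stLift_of_uncurry (u := fun _ : ℝ => w) hw2.1.comp_snd
  -- space–time square integrability
  · rw [setLIntegral_const]
    exact ENNReal.mul_lt_top hL2fin measure_Ioo_lt_top
  -- the weak identity with datum
  · have hkey : ∫ t in Ioo 0 T, ∫ x, (⟪w x, Torus.timeDeriv ψ t x⟫_ℝ + ⟪w x, convect w (ψ t) x⟫_ℝ +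
        ν * ⟪w x, laplacian (ψ t) x⟫_ℝ + ⟪f x, ψ t x⟫_ℝ) =
        ∫ t in Ioo 0 T, ∫ x, ⟪w x, Torus.timeDeriv ψ t x⟫_ℝ := by
      refine setIntegral_congr_fun measurableSet_Ioo fun t _ => ?_
      have i1 : Integrable (fun x => ⟪w x, Torus.timeDeriv ψ t x⟫_ℝ) volume :=
        integrable_inner_timeDeriv_slice (U := fun _ => w) hψ hw2
      have i2 : Integrable (fun x => ⟪w x, convect w (ψ t) x⟫_ℝ) volume :=
        integrable_inner_convect_of_memLp hw2 (hψ.isSmooth_slice t)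
      have i3 : Integrable (fun x => ν * ⟪w x, laplacian (ψ t) x⟫_ℝ) volume :=
        (integrable_inner_of_continuous hw1 (hψ.isSmooth_slice t).laplacian.continuous).const_mul ν
      have i4 : Integrable (fun x => ⟪f x, ψ t x⟫_ℝ) volume :=
        (hf.inner (hψ.isSmooth_slice t)).integrable
      have i234 : Integrable (fun x => ⟪w x, convect w (ψ t) x⟫_ℝ +
          ν * ⟪w x, laplacian (ψ t) x⟫_ℝ + ⟪f x, ψ t x⟫_ℝ) volume := (i2.add i3).add i4
      have hsum : (fun x => ⟪w x, Torus.timeDeriv ψ t x⟫_ℝ + ⟪w x, convect w (ψ t) x⟫_ℝ +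
          ν * ⟪w x, laplacian (ψ t) x⟫_ℝ + ⟪f x, ψ t x⟫_ℝ) =
          fun x => ⟪w x, Torus.timeDeriv ψ t x⟫_ℝ + (⟪w x, convect w (ψ t) x⟫_ℝ +
            ν * ⟪w x, laplacian (ψ t) x⟫_ℝ + ⟪f x, ψ t x⟫_ℝ) := by
        funext x
        ring
      rw [hsum, integral_add i1 i234, htest (ψ t) (hψ.isSmooth_slice t) (hψdiv t), add_zero]
    rw [hkey, setIntegral_integral_inner_timeDeriv_eq_neg hT hψ hw2, neg_add_cancel]
  -- `L^∞ L²`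
  · exact (ENNReal.coe_toNNReal hL2fin.ne).ge
  -- `L² H¹`
  · rw [eL2SobolevNorm, setLIntegral_const]
    exact ENNReal.rpow_lt_top_of_nonneg (by norm_num)
      (ENNReal.mul_ne_top (ENNReal.pow_ne_top hH1.2.ne) measure_Ioo_lt_top.ne)
  -- energy inequality from `0` (equality)
  · rw [hdiss 0 t ht.1]
  -- energy inequality from every `s` (equality)
  · rw [hdiss s t hst.1]
  -- strong attainment of the datum
  · simp only [sub_self, eLpNorm_zero]
    exact tendsto_const_nhds

/-- **A steady weak solution in `V` with the energy equation is a global Leray–Hopf solution**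
(as the constant path from its own datum; Galdi 2000, Def. 2.1; Robinson–Rodrigo–Sadowski
2016, Def. 4.9; `f` smooth with zero mean). [folklore] -/
theorem isGlobalLerayHopf_steady {ν : ℝ} {f : UnitAddTorus (Fin 3) → EuclideanSpace ℝ (Fin 3)}
    {u : energySpace (Fin 3)} (hf : IsSmooth f) (hzf : HasZeroMean f)
    (hV : (u : Lp (EuclideanSpace ℝ (Fin 3)) 2 (volume : Measure (UnitAddTorus (Fin 3)))) ∈
      energySpaceV (Fin 3))
    (hsol : IsSteadyWeakSolution ν f u)
    (heq : ν * (eGradNormSq ((u : Lp (EuclideanSpace ℝ (Fin 3)) 2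
        (volume : Measure (UnitAddTorus (Fin 3)))) :
          UnitAddTorus (Fin 3) → EuclideanSpace ℝ (Fin 3))).toReal =
      pairing (u : Lp (EuclideanSpace ℝ (Fin 3)) 2 (volume : Measure (UnitAddTorus (Fin 3)))) f) :
    IsGlobalLerayHopf ν (fun _ => f)
      ((u : Lp (EuclideanSpace ℝ (Fin 3)) 2 (volume : Measure (UnitAddTorus (Fin 3)))) :
        UnitAddTorus (Fin 3) → EuclideanSpace ℝ (Fin 3))
      (fun _ => ((u : Lp (EuclideanSpace ℝ (Fin 3)) 2 (volume : Measure (UnitAddTorus (Fin 3)))) :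
        UnitAddTorus (Fin 3) → EuclideanSpace ℝ (Fin 3))) := by
  intro T hT
  have hw2 : MemLp ((u : Lp (EuclideanSpace ℝ (Fin 3)) 2 (volume : Measure (UnitAddTorus (Fin 3)))) :
      UnitAddTorus (Fin 3) → EuclideanSpace ℝ (Fin 3)) 2 volume := Lp.memLp _
  have hdivw := ((mem_energySpace_iff_holds _).1 u.2).1
  have hK : ∫ x, ⟪f x, ((u : Lp (EuclideanSpace ℝ (Fin 3)) 2
      (volume : Measure (UnitAddTorus (Fin 3)))) : UnitAddTorus (Fin 3) → EuclideanSpace ℝ (Fin 3)) x⟫_ℝ =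
      ν * (eGradNormSq ((u : Lp (EuclideanSpace ℝ (Fin 3)) 2
        (volume : Measure (UnitAddTorus (Fin 3)))) : UnitAddTorus (Fin 3) → EuclideanSpace ℝ (Fin 3))).toReal := by
    rw [heq, pairing]
    exact integral_congr_ae (ae_of_all _ fun x => real_inner_comm _ _)
  exact isLerayHopfOn_steady hT hf hw2 hV.2 hdivw
    (fun a ha hadiv => integral_tested_eq_zero_of_isSteadyWeakSolution hf hzf hsol ha hadiv) hK

/-- **Route decl `SteadyWeakIsGlobalLerayHopf` (stmt-AnomalousDissipation-2992), proved**: a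
steady weak solution `u ∈ V` with the energy equation, viewed as the constant path, is a global
Leray–Hopf solution from `u` with `meanEnergy = ∫ |u|²` and `meanDissipation = ν ‖∇u‖²`
(`isGlobalLerayHopf_steady`; the means by `meanEnergy_eq_of_periodic` / `meanDissipation_eq_of_periodic`
with period `1`). [folklore] -/
theorem steadyWeakIsGlobalLerayHopf_proof :
    Summit.AnomalousDissipation.AnomalousDissipation.Theses.MirrorVariety.SteadyWeakIsGlobalLerayHopf := by
  intro ν f u _hν hf hzf hV hsol heq
  refine ⟨isGlobalLerayHopf_steady hf hzf hV hsol heq, ?_, ?_⟩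
  · -- mean energy of the constant (`1`-periodic) path
    rw [meanEnergy_eq_of_periodic (τ := 1) (fun _ => rfl) one_pos]
    simp
  · -- mean dissipation of the constant (`1`-periodic) path
    rw [meanDissipation_eq_of_periodic (τ := 1) (fun _ => rfl) one_pos]
    simp

end Summit.AnomalousDissipation.AnomalousDissipation.Theorems

end
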